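import Literature.Barriers.AtomisticToContinuum.AnticontinuumLocalizationThm1Window
import Literature.Probability.Distributions.GaussianSlabs
import HarnessLib

/-!
# De Roeck–Huveneers 2015, §5.6 for the rotor chain: the majorant lemma

`Literature/Barriers/AtomisticToContinuum/` — the measure-theoretic packaging of the bounds (5.17):
a family of phase-space functions dominated pointwise by
`(𝟙_Z(ω) K₁ ε^{a₁} + K₂ ε^{a₂}) (1 + ‖ω‖)^M`, with `Z` of doubled-variance Gaussian measure
`≤ C_Z ε^{e_Z}`, admits a measurable majorant `u(ω)` with `∫ u² d𝒩(0,T)^{⊗m} ≤ C ε^{tgt}` as soon as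
`tgt ≤ 2a₁ + e_Z` and `tgt ≤ 2a₂` — the shape of the four bounds of Theorem 1 (`exists_majorant`),
with `C = 2K₁²K C_Z + 2K₂²K` independent of `ε` (`K` the absorption constant of
`Literature/Probability/Distributions/GaussianSlabs.lean`). PROVED. [cite: DeRoeckHuveneers2015, §5.6 (5.15)–(5.17)]
-/

noncomputable section

open MeasureTheory ProbabilityTheory Function Set Finset Filter
open scoped ENNReal NNReal BigOperators Topology

namespace Literature.Barriers.AtomisticToContinuum.HeatConduction.RotorChain

open Literature.MathematicalPhysics.KineticTheory.HeatConduction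

variable {m : ℕ}

/-- `(x + y)² ≤ 2x² + 2y²`. [folklore] -/
theorem add_sq_le_two_mul (x y : ℝ) : (x + y) ^ 2 ≤ 2 * x ^ 2 + 2 * y ^ 2 := by nlinarith [sq_nonneg (x - y)]

/-- **The majorant lemma.** For functions `F_i` on phase space with
`|F_i(q, ω)| ≤ (𝟙_Z(ω) K₁ ε^{a₁} + K₂ ε^{a₂}) (1 + ‖ω‖)^M`, `𝒩(0,2T)^{⊗m}(Z) ≤ C_Z ε^{e_Z}`, and the
absorption constant `K` for the weight `(1 + ‖ω‖)^{2M}`: there is a measurable `u(ω) ≥ |F_i|` with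
`∫ u² d𝒩(0,T)^{⊗m} ≤ (2K₁²K C_Z + 2K₂²K) ε^{tgt}` whenever `tgt ≤ 2a₁ + e_Z`, `tgt ≤ 2a₂`, `0 < ε ≤ 1`.
[cite: DeRoeckHuveneers2015, §5.6 ("`⟨F, A_Z F⟩ ≤ sup|F|² ⟨χ_Z⟩`" and "`p(ω)² e^{-|ω|²/2T} ≤ C e^{-|ω|²/4T}`")] -/
theorem exists_majorant {M : ℕ} {T : ℝ} {K : ℝ} (hK0 : 0 ≤ K)
    (hK : ∀ S : Set (Fin m → ℝ), MeasurableSet S →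
      ∫⁻ w, S.indicator (fun w => ENNReal.ofReal ((1 + ‖w‖) ^ (2 * M))) w ∂(Measure.pi fun _ : Fin m => gaussianReal 0 T.toNNReal) ≤
        ENNReal.ofReal K * (Measure.pi fun _ : Fin m => gaussianReal 0 (2 * T.toNNReal)) S)
    {Z : Set (Fin m → ℝ)} (hZm : MeasurableSet Z) {ι : Type*} (F : ι → PhaseSpace m → ℝ)
    {K₁ K₂ : ℝ} (hK₁ : 0 ≤ K₁) (hK₂ : 0 ≤ K₂) {ε : ℝ} (hε : 0 < ε) (hε1 : ε ≤ 1) {a₁ a₂ eZ tgt CZ : ℝ} (hCZ : 0 ≤ CZ)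
    (hpt : ∀ i z, |F i z| ≤ (Z.indicator (fun _ => (1 : ℝ)) z.2 * K₁ * ε ^ a₁ + K₂ * ε ^ a₂) * (1 + ‖z.2‖) ^ M)
    (hZ : (Measure.pi fun _ : Fin m => gaussianReal 0 (2 * T.toNNReal)) Z ≤ ENNReal.ofReal (CZ * ε ^ eZ))
    (h1 : tgt ≤ 2 * a₁ + eZ) (h2 : tgt ≤ 2 * a₂) :
    ∃ u : (Fin m → ℝ) → ℝ≥0∞, Measurable u ∧ (∀ i z, ‖F i z‖ₑ ≤ u z.2) ∧
      ∫⁻ w, u w ^ 2 ∂(Measure.pi fun _ : Fin m => gaussianReal 0 T.toNNReal) ≤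
        ENNReal.ofReal ((2 * K₁ ^ 2 * K * CZ + 2 * K₂ ^ 2 * K) * ε ^ tgt) := by
  set μ : Measure (Fin m → ℝ) := Measure.pi fun _ : Fin m => gaussianReal 0 T.toNNReal with hμ
  set μ₂ : Measure (Fin m → ℝ) := Measure.pi fun _ : Fin m => gaussianReal 0 (2 * T.toNNReal) with hμ₂
  set g : (Fin m → ℝ) → ℝ := fun w => (Z.indicator (fun _ => (1 : ℝ)) w * K₁ * ε ^ a₁ + K₂ * ε ^ a₂) * (1 + ‖w‖) ^ M with hg
  have hχ : ∀ w, 0 ≤ Z.indicator (fun _ => (1 : ℝ)) w := fun w => Set.indicator_nonneg (fun _ _ => zero_le_one) w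
  have hε' : ∀ a : ℝ, 0 ≤ ε ^ a := fun a => Real.rpow_nonneg hε.le a
  have hg0 : ∀ w, 0 ≤ g w := fun w => by
    have := hχ w; have := hε' a₁; have := hε' a₂
    positivity
  have hgm : Measurable g := by
    refine Measurable.mul (Measurable.add ?_ measurable_const) ((measurable_const.add measurable_norm).pow_const M)
    exact ((measurable_const.indicator hZm).mul measurable_const).mul measurable_const
  refine ⟨fun w => ENNReal.ofReal (g w), hgm.ennreal_ofReal, fun i z => ?_, ?_⟩
  · rw [Real.enorm_eq_ofReal_abs]
    exact ENNReal.ofReal_le_ofReal (hpt i z)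
  · -- square and split
    set W : (Fin m → ℝ) → ℝ := fun w => (1 + ‖w‖) ^ (2 * M) with hW
    have hW0 : ∀ w, 0 ≤ W w := fun w => by positivity
    have hsq : ∀ w, g w ^ 2 ≤ 2 * (K₁ ^ 2 * ε ^ (2 * a₁)) * (Z.indicator W w) + 2 * (K₂ ^ 2 * ε ^ (2 * a₂)) * W w := by
      intro w
      have eW : ((1 + ‖w‖) ^ M) ^ 2 = W w := by rw [hW]; ring
      have e1 : (ε ^ a₁) ^ 2 = ε ^ (2 * a₁) := by rw [← Real.rpow_natCast, ← Real.rpow_mul hε.le]; ring_nf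
      have e2 : (ε ^ a₂) ^ 2 = ε ^ (2 * a₂) := by rw [← Real.rpow_natCast, ← Real.rpow_mul hε.le]; ring_nf
      by_cases hw : w ∈ Z
      · have hi : Z.indicator (fun _ => (1 : ℝ)) w = 1 := Set.indicator_of_mem hw _
        have hiW : Z.indicator W w = W w := Set.indicator_of_mem hw _
        rw [hg]; simp only [hi, one_mul, hiW]
        rw [mul_pow, eW]
        have := add_sq_le_two_mul (K₁ * ε ^ a₁) (K₂ * ε ^ a₂)
        calc (K₁ * ε ^ a₁ + K₂ * ε ^ a₂) ^ 2 * W w ≤ (2 * (K₁ * ε ^ a₁) ^ 2 + 2 * (K₂ * ε ^ a₂) ^ 2) * W w :=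
              mul_le_mul_of_nonneg_right this (hW0 w)
          _ = 2 * (K₁ ^ 2 * ε ^ (2 * a₁)) * W w + 2 * (K₂ ^ 2 * ε ^ (2 * a₂)) * W w := by rw [mul_pow, mul_pow, e1, e2]; ring
      · have hi : Z.indicator (fun _ => (1 : ℝ)) w = 0 := Set.indicator_of_notMem hw _
        have hiW : Z.indicator W w = 0 := Set.indicator_of_notMem hw _
        rw [hg]; simp only [hi, zero_mul, zero_add, hiW, mul_zero]
        rw [mul_pow, eW, mul_pow, e2]
        have : 0 ≤ K₂ ^ 2 * ε ^ (2 * a₂) * W w := by have := hε' (2 * a₂); positivity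
        nlinarith
    -- the two integrals
    have hWre : Measurable W := (measurable_const.add measurable_norm).pow_const _
    have hWm : Measurable fun w => ENNReal.ofReal (W w) := hWre.ennreal_ofReal
    have hZW : Measurable fun w => ENNReal.ofReal (Z.indicator W w) := (hWre.indicator hZm).ennreal_ofReal
    have hI1 : ∫⁻ w, ENNReal.ofReal (Z.indicator W w) ∂μ ≤ ENNReal.ofReal K * μ₂ Z := by
      have e : (fun w => ENNReal.ofReal (Z.indicator W w)) = Z.indicator fun w => ENNReal.ofReal ((1 + ‖w‖) ^ (2 * M)) := by
        funext w; by_cases hw : w ∈ Z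
        · simp [Set.indicator_of_mem hw, hW]
        · simp [Set.indicator_of_notMem hw]
      rw [e]; exact hK Z hZm
    have hI2 : ∫⁻ w, ENNReal.ofReal (W w) ∂μ ≤ ENNReal.ofReal K := by
      have e : (fun w => ENNReal.ofReal (W w)) = Set.univ.indicator fun w => ENNReal.ofReal ((1 + ‖w‖) ^ (2 * M)) := by
        funext w; simp [hW]
      rw [e]
      refine (hK Set.univ MeasurableSet.univ).trans ?_
      rw [measure_univ, mul_one]
    set c₁ : ℝ := 2 * (K₁ ^ 2 * ε ^ (2 * a₁)) with hc₁
    set c₂ : ℝ := 2 * (K₂ ^ 2 * ε ^ (2 * a₂)) with hc₂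
    have hc₁0 : 0 ≤ c₁ := by have := hε' (2 * a₁); positivity
    have hc₂0 : 0 ≤ c₂ := by have := hε' (2 * a₂); positivity
    have hfin : c₁ * (K * (CZ * ε ^ eZ)) + c₂ * K ≤ (2 * K₁ ^ 2 * K * CZ + 2 * K₂ ^ 2 * K) * ε ^ tgt := by
      have hp1 : ε ^ (2 * a₁) * ε ^ eZ ≤ ε ^ tgt := by
        rw [← Real.rpow_add hε]; exact Real.rpow_le_rpow_of_exponent_ge hε hε1 h1
      have hp2 : ε ^ (2 * a₂) ≤ ε ^ tgt := Real.rpow_le_rpow_of_exponent_ge hε hε1 h2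
      have hA : 0 ≤ 2 * K₁ ^ 2 * K * CZ := by positivity
      have hB : 0 ≤ 2 * K₂ ^ 2 * K := by positivity
      calc c₁ * (K * (CZ * ε ^ eZ)) + c₂ * K
          = (2 * K₁ ^ 2 * K * CZ) * (ε ^ (2 * a₁) * ε ^ eZ) + (2 * K₂ ^ 2 * K) * ε ^ (2 * a₂) := by rw [hc₁, hc₂]; ring
        _ ≤ (2 * K₁ ^ 2 * K * CZ) * ε ^ tgt + (2 * K₂ ^ 2 * K) * ε ^ tgt := by gcongr
        _ = (2 * K₁ ^ 2 * K * CZ + 2 * K₂ ^ 2 * K) * ε ^ tgt := by ring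
    calc ∫⁻ w, ENNReal.ofReal (g w) ^ 2 ∂μ
        = ∫⁻ w, ENNReal.ofReal (g w ^ 2) ∂μ := lintegral_congr fun w => by rw [ENNReal.ofReal_pow (hg0 w)]
      _ ≤ ∫⁻ w, ENNReal.ofReal c₁ * ENNReal.ofReal (Z.indicator W w) + ENNReal.ofReal c₂ * ENNReal.ofReal (W w) ∂μ := by
          refine lintegral_mono fun w => ?_
          have hi0 : 0 ≤ Z.indicator W w := Set.indicator_nonneg (fun w _ => hW0 w) w
          rw [← ENNReal.ofReal_mul hc₁0, ← ENNReal.ofReal_mul hc₂0,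
            ← ENNReal.ofReal_add (mul_nonneg hc₁0 hi0) (mul_nonneg hc₂0 (hW0 w))]
          exact ENNReal.ofReal_le_ofReal (hsq w)
      _ = ENNReal.ofReal c₁ * ∫⁻ w, ENNReal.ofReal (Z.indicator W w) ∂μ + ENNReal.ofReal c₂ * ∫⁻ w, ENNReal.ofReal (W w) ∂μ := by
          rw [lintegral_add_left ((hZW.const_mul _)), lintegral_const_mul _ hZW, lintegral_const_mul _ hWm]
      _ ≤ ENNReal.ofReal c₁ * (ENNReal.ofReal K * ENNReal.ofReal (CZ * ε ^ eZ)) + ENNReal.ofReal c₂ * ENNReal.ofReal K := by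
          gcongr
          exact hI1.trans (mul_le_mul_right hZ _)
      _ = ENNReal.ofReal (c₁ * (K * (CZ * ε ^ eZ)) + c₂ * K) := by
          rw [← ENNReal.ofReal_mul hK0, ← ENNReal.ofReal_mul hc₁0, ← ENNReal.ofReal_mul hc₂0,
            ← ENNReal.ofReal_add (by have := hε' eZ; positivity) (by positivity)]
      _ ≤ ENNReal.ofReal ((2 * K₁ ^ 2 * K * CZ + 2 * K₂ ^ 2 * K) * ε ^ tgt) := ENNReal.ofReal_le_ofReal hfin

end Literature.Barriers.AtomisticToContinuum.HeatConduction.RotorChain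

end
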